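import Mathlib
import Literature.MathematicalPhysics.KineticTheory.HardSphereEuler

/-!
# Projective (Kidder / Schrödinger) covariance of the full Euler system of a monatomic gas with a
# general equation of state — stub `stub_projectiveCovariance`

Crux `Summit.AtomisticToContinuum.HydrodynamicLimit.Theses.ImplosionDichotomy.DenseExcursion`
(stmt-AtomisticToContinuum-12586), line `kidder-knob-melnikov`, registered stub
`stub_projectiveCovariance : ProjectiveCovariance`. The statement and the block of line-posited
definitions `clockMap`, `dualDensity`, `dualTemperature`, `dualVelocity`, `dT`, `dX`, `EulerZAt`,
`ProjectiveCovariance` are copied verbatim from the skeleton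
`Cruxes/DenseExcursion/Lines/kidder-knob-melnikov.lean`; they are shared character for character
with stub 3 of the sibling line `Cruxes/PolynomialCompression/Lines/conformal-clock.lean`
(stmt-AtomisticToContinuum-12587), so this one proof serves both.

**Mathematics.** Write `λ = a/(a+s)`, `λ' = dλ/ds = -λ²/a`, `(t, x) = clockMap a (s, y) =
(a s/(a+s), λ y)`, so that `dt/ds = λ²`, `∂x/∂s = λ' y`, `∂x/∂y = λ·Id`. For the dual fields
`ρ̂ = λ³ ρ∘clockMap`, `θ̂ = λ² θ∘clockMap`, `û = λ u∘clockMap + y/(a+s)` the chain and product rules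
give at a point `z = (s, y)` with `a + s ≠ 0`: dual mass residual `= λ⁵ ·` physical one
(`dual_mass`); dual momentum residual `= λ⁶ ·` physical one (`dual_momentum`; the packing
`ρ̂ d(s)³ = ρ σ³` is invariant for the growing diameter `d(s) = σ(a+s)/a`, so the pressure
`ρ θ Z(ρ d³)` is covariant); dual temperature residual `= λ⁴ ·` physical one once the typed heating
`(2/(a+s)) θ̂ (Z − 1)` is subtracted (`dual_temperature`). Whence the three equivalences, `λ ≠ 0`.
At `Z ≡ 1` this is the projective invariance of the monatomic ideal gas (D. Serre, Ann. Inst.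
Fourier 47 (1997), Prop. 2.1; R. E. Kidder, Nucl. Fusion 14 (1974)); as typed it is a
finite-dimensional `fderiv` computation, and every lemma below is folklore calculus.

**Design.** Derivatives of composites with `clockMap a` are computed once
(`fderiv_comp_clockMap_time/space`); the dual fields are products of powers of the clock factor
with such composites, differentiated by `HasFDerivAt.mul/add`, evaluated on the directions
`(1, 0)`, `(0, eᵢ)`, and the residual identities are closed by `field_simp; ring`.
-/

noncomputable section

open Literature.MathematicalPhysics.KineticTheory (T3 V3)

namespace Summit.AtomisticToContinuum.HydrodynamicLimit.Theorems.KidderKnobMelnikov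

/-! ## The line-posited definitions (verbatim: skeleton `kidder-knob-melnikov.lean`, Stub 0) -/

/-- The projective point map with parameter `a`: dual `(s, y) ↦` physical `(t, x) = (a s/(a+s), (a/(a+s)) y)`. -/
def clockMap (a : ℝ) (z : ℝ × V3) : ℝ × V3 := (a * z.1 / (a + z.1), (a / (a + z.1)) • z.2)

/-- Dual density `ρ̂(s,y) = λ³ ρ(t,x)`, `λ = a/(a+s)`. -/
def dualDensity (a : ℝ) (P : ℝ × V3 → ℝ) (z : ℝ × V3) : ℝ := (a / (a + z.1)) ^ 3 * P (clockMap a z)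

/-- Dual temperature `θ̂(s,y) = λ² θ(t,x)`. -/
def dualTemperature (a : ℝ) (Θ : ℝ × V3 → ℝ) (z : ℝ × V3) : ℝ := (a / (a + z.1)) ^ 2 * Θ (clockMap a z)

/-- Dual velocity `û(s,y) = λ u(t,x) + y/(a+s)`. -/
def dualVelocity (a : ℝ) (U : ℝ × V3 → V3) (z : ℝ × V3) : V3 :=
  (a / (a + z.1)) • U (clockMap a z) + (1 / (a + z.1)) • z.2

/-- `∂ₜ F (z)` on `ℝ × ℝ³`. -/
def dT {G : Type*} [NormedAddCommGroup G] [NormedSpace ℝ G] (F : ℝ × V3 → G) (z : ℝ × V3) : G :=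
  fderiv ℝ F z ((1 : ℝ), (0 : V3))

/-- `∂ᵢ F (z)` on `ℝ × ℝ³`. -/
def dX {G : Type*} [NormedAddCommGroup G] [NormedSpace ℝ G] (i : Fin 3) (F : ℝ × V3 → G) (z : ℝ × V3) : G :=
  fderiv ℝ F z ((0 : ℝ), EuclideanSpace.single i (1 : ℝ))

/-- The full Euler system of a monatomic gas (`e = 3θ/2`) with pressure law `p = ρ θ Z(ρ d(t)³)` (diameter
`d(t)`) and heating rate `h(t) θ (Z − 1)` at `z = (t, x) ∈ ℝ × ℝ³`, non-conservative form. Physical hard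
spheres: `d ≡ σ`, `h ≡ 0`; Kidder dual: `d(s) = σ(a+s)/a`, `h(s) = 2/(a+s)`. -/
def EulerZAt (d h : ℝ → ℝ) (Z : ℝ → ℝ) (P Θ : ℝ × V3 → ℝ) (U : ℝ × V3 → V3) (z : ℝ × V3) : Prop :=
  dT P z + ∑ i, dX i (fun w => P w * U w i) z = 0 ∧
  (∀ j : Fin 3, P z * (dT (fun w => U w j) z + ∑ i, U z i * dX i (fun w => U w j) z) +
      dX j (fun w => P w * Θ w * Z (P w * d w.1 ^ 3)) z = 0) ∧
  dT Θ z + ∑ i, U z i * dX i Θ z + (2 / 3) * Θ z * Z (P z * d z.1 ^ 3) * ∑ i, dX i (fun w => U w i) z =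
      h z.1 * Θ z * (Z (P z * d z.1 ^ 3) - 1)

/-- Statement of `stub_projectiveCovariance` (= the sibling line's `ProjectiveCovariance`): for every
`C¹`-at-the-point triple and every equation of state `Z` differentiable at the (projectively invariant)
packing, the physical system with diameter `σ` and no heating holds at `clockMap a (s,y)` iff the dual
system with growing diameter `σ(a+s)/a` and heating rate `2/(a+s)` holds at `(s,y)` for the dual fields.
At `Z ≡ 1` this is the projective symmetry of the monatomic ideal gas (Serre 1997, Prop. 2.1; Kidder 1974)
— the symmetry that generates the knob. -/
def ProjectiveCovariance : Prop :=
  ∀ (a σ : ℝ), 0 < a → ∀ (Z : ℝ → ℝ) (P Θ : ℝ × V3 → ℝ) (U : ℝ × V3 → V3) (z : ℝ × V3), 0 ≤ z.1 →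
    DifferentiableAt ℝ P (clockMap a z) → DifferentiableAt ℝ Θ (clockMap a z) →
    DifferentiableAt ℝ U (clockMap a z) → DifferentiableAt ℝ Z (P (clockMap a z) * σ ^ 3) →
    (EulerZAt (fun _ => σ) (fun _ => 0) Z P Θ U (clockMap a z) ↔
      EulerZAt (fun s => σ * (a + s) / a) (fun s => 2 / (a + s)) Z
        (dualDensity a P) (dualTemperature a Θ) (dualVelocity a U) z)

/-! ## Linear algebra on `ℝ × ℝ³` -/

section LinearAlgebra

variable {G : Type*} [NormedAddCommGroup G] [NormedSpace ℝ G]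

/-- `y = ∑ᵢ yᵢ eᵢ` in `ℝ³ = EuclideanSpace ℝ (Fin 3)`. [folklore] -/
theorem sum_smul_single (y : V3) : ∑ i, y i • EuclideanSpace.single i (1 : ℝ) = y := by
  simpa only [EuclideanSpace.basisFun_apply, EuclideanSpace.basisFun_repr] using
    (EuclideanSpace.basisFun (Fin 3) ℝ).sum_repr y

/-- A continuous linear map on `ℝ × ℝ³` evaluated at `(r, s • y)` splits along the time direction
`(1, 0)` and the spatial basis directions `(0, eᵢ)`. [folklore] -/
theorem clm_apply_mk_smul (L : ℝ × V3 →L[ℝ] G) (r s : ℝ) (y : V3) :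
    L (r, s • y) = r • L (1, 0) + s • ∑ i, y i • L (0, EuclideanSpace.single i 1) := by
  have h : ((r, s • y) : ℝ × V3) =
      r • ((1 : ℝ), (0 : V3)) + s • ∑ i, y i • ((0 : ℝ), EuclideanSpace.single i (1 : ℝ)) := by
    refine Prod.ext ?_ ?_
    · simp [Prod.fst_sum]
    · simp [Prod.snd_sum, sum_smul_single]
  rw [h, map_add, map_smul, map_smul, map_sum]
  simp_rw [map_smul]

/-- `L (0, s • v) = s • L (0, v)` for a continuous linear map on `ℝ × ℝ³`. [folklore] -/
theorem clm_apply_zero_smul (L : ℝ × V3 →L[ℝ] G) (s : ℝ) (v : V3) :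
    L (0, s • v) = s • L (0, v) := by
  rw [← map_smul]
  exact congrArg L (Prod.ext (by simp) (by simp))

end LinearAlgebra

/-! ## Calculus of the clock map -/

section ClockCalculus

variable {G : Type*} [NormedAddCommGroup G] [NormedSpace ℝ G] {a : ℝ} {z : ℝ × V3}

/-- `∂ₛ (c/(a+s)) = -c/(a+s)²` on `ℝ × ℝ³`: `c = a` is the clock factor `λ` (`λ' = -λ²/a`),
`c = 1` the Hubble coefficient of the dual velocity. [folklore] -/
theorem hasFDerivAt_const_div_clock (hm : a + z.1 ≠ 0) (c : ℝ) :
    HasFDerivAt (fun w : ℝ × V3 => c / (a + w.1))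
      ((-c / (a + z.1) ^ 2) • ContinuousLinearMap.fst ℝ ℝ V3) z := by
  have h : HasDerivAt (fun x : ℝ => c / (a + x)) (-c / (a + z.1) ^ 2) z.1 := by
    refine ((hasDerivAt_const z.1 c).div ((hasDerivAt_id' z.1).const_add a) hm).congr_deriv ?_
    ring
  exact h.comp_hasFDerivAt z hasFDerivAt_fst

/-- `∂ₛ (a/(a+s))ⁿ = n (a/(a+s))ⁿ⁻¹ · (-a/(a+s)²)`. [folklore] -/
theorem hasFDerivAt_clockFactor_pow (hm : a + z.1 ≠ 0) (n : ℕ) :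
    HasFDerivAt (fun w : ℝ × V3 => (a / (a + w.1)) ^ n)
      (((n : ℝ) * (a / (a + z.1)) ^ (n - 1) * (-a / (a + z.1) ^ 2)) •
        ContinuousLinearMap.fst ℝ ℝ V3) z := by
  have h1 : HasDerivAt (fun x : ℝ => a / (a + x)) (-a / (a + z.1) ^ 2) z.1 := by
    refine ((hasDerivAt_const z.1 a).div ((hasDerivAt_id' z.1).const_add a) hm).congr_deriv ?_
    ring
  exact (h1.fun_pow n).comp_hasFDerivAt z hasFDerivAt_fst

/-- `∂ₛ (a s/(a+s)) = a²/(a+s)² = λ²` (the physical time runs at rate `λ²`). [folklore] -/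
theorem hasFDerivAt_clockTime (hm : a + z.1 ≠ 0) :
    HasFDerivAt (fun w : ℝ × V3 => a * w.1 / (a + w.1))
      ((a ^ 2 / (a + z.1) ^ 2) • ContinuousLinearMap.fst ℝ ℝ V3) z := by
  have h : HasDerivAt (fun x : ℝ => a * x / (a + x)) (a ^ 2 / (a + z.1) ^ 2) z.1 := by
    refine (((hasDerivAt_id' z.1).const_mul a).div ((hasDerivAt_id' z.1).const_add a)
      hm).congr_deriv ?_
    ring
  exact h.comp_hasFDerivAt z hasFDerivAt_fst

/-- The coordinate function `w ↦ yⱼ` on `ℝ × ℝ³`. [folklore] -/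
theorem hasFDerivAt_coord (z : ℝ × V3) (j : Fin 3) :
    HasFDerivAt (fun w : ℝ × V3 => w.2 j)
      ((PiLp.proj 2 (fun _ : Fin 3 => ℝ) j).comp (ContinuousLinearMap.snd ℝ ℝ V3)) z :=
  (PiLp.hasFDerivAt_apply (𝕜 := ℝ) 2 z.2 j).comp z hasFDerivAt_snd

/-- The Fréchet derivative of the clock map: `D(clockMap a)(s,y)(σ', η) = (λ² σ', λ η + λ' σ' y)`.
[folklore] -/
theorem hasFDerivAt_clockMap (hm : a + z.1 ≠ 0) :
    HasFDerivAt (clockMap a)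
      (((a ^ 2 / (a + z.1) ^ 2) • ContinuousLinearMap.fst ℝ ℝ V3).prod
        ((a / (a + z.1)) • ContinuousLinearMap.snd ℝ ℝ V3 +
          ((-a / (a + z.1) ^ 2) • ContinuousLinearMap.fst ℝ ℝ V3).smulRight z.2)) z :=
  (hasFDerivAt_clockTime hm).prodMk ((hasFDerivAt_const_div_clock hm a).fun_smul hasFDerivAt_snd)

/-- Chain rule through the clock map. [folklore] -/
theorem hasFDerivAt_comp_clockMap {F : ℝ × V3 → G} (hm : a + z.1 ≠ 0)
    (hF : DifferentiableAt ℝ F (clockMap a z)) :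
    HasFDerivAt (fun w => F (clockMap a w))
      ((fderiv ℝ F (clockMap a z)).comp
        (((a ^ 2 / (a + z.1) ^ 2) • ContinuousLinearMap.fst ℝ ℝ V3).prod
          ((a / (a + z.1)) • ContinuousLinearMap.snd ℝ ℝ V3 +
            ((-a / (a + z.1) ^ 2) • ContinuousLinearMap.fst ℝ ℝ V3).smulRight z.2))) z :=
  hF.hasFDerivAt.comp z (hasFDerivAt_clockMap hm)

/-- Time derivative of a composite with the clock map:
`∂ₛ (F ∘ clockMap a)(s,y) = λ² ∂ₜF + λ' ∑ᵢ yᵢ ∂ᵢF` at `clockMap a (s,y)`. [folklore] -/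
theorem fderiv_comp_clockMap_time {F : ℝ × V3 → G} (hm : a + z.1 ≠ 0)
    (hF : DifferentiableAt ℝ F (clockMap a z)) :
    fderiv ℝ (fun w => F (clockMap a w)) z (1, 0) =
      (a ^ 2 / (a + z.1) ^ 2) • fderiv ℝ F (clockMap a z) (1, 0) +
        (-a / (a + z.1) ^ 2) • ∑ i, z.2 i • fderiv ℝ F (clockMap a z)
          (0, EuclideanSpace.single i 1) := by
  rw [(hasFDerivAt_comp_clockMap hm hF).fderiv]
  simp only [ContinuousLinearMap.coe_comp, Function.comp_apply, ContinuousLinearMap.prod_apply,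
    smul_apply, ContinuousLinearMap.coe_fst', ContinuousLinearMap.coe_snd', add_apply,
    ContinuousLinearMap.smulRight_apply, smul_zero, zero_add, smul_eq_mul, mul_one]
  rw [clm_apply_mk_smul]

/-- Space derivatives of a composite with the clock map:
`∂ᵢ (F ∘ clockMap a)(s,y) = λ ∂ᵢF` at `clockMap a (s,y)`. [folklore] -/
theorem fderiv_comp_clockMap_space {F : ℝ × V3 → G} (hm : a + z.1 ≠ 0)
    (hF : DifferentiableAt ℝ F (clockMap a z)) (i : Fin 3) :
    fderiv ℝ (fun w => F (clockMap a w)) z (0, EuclideanSpace.single i 1) =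
      (a / (a + z.1)) • fderiv ℝ F (clockMap a z) (0, EuclideanSpace.single i 1) := by
  rw [(hasFDerivAt_comp_clockMap hm hF).fderiv]
  simp only [ContinuousLinearMap.coe_comp, Function.comp_apply, ContinuousLinearMap.prod_apply,
    smul_apply, ContinuousLinearMap.coe_fst', ContinuousLinearMap.coe_snd', add_apply,
    ContinuousLinearMap.smulRight_apply, add_zero, smul_eq_mul, mul_zero, zero_smul]
  rw [clm_apply_zero_smul]

/-- The dual velocity, componentwise. [folklore] -/
theorem dualVelocity_apply (a : ℝ) (U : ℝ × V3 → V3) (w : ℝ × V3) (j : Fin 3) :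
    dualVelocity a U w j = a / (a + w.1) * U (clockMap a w) j + 1 / (a + w.1) * w.2 j := by
  simp only [dualVelocity, PiLp.add_apply, PiLp.smul_apply, smul_eq_mul]

/-- Derivative of a component of the dual velocity (a `C¹`-at-the-point composite). [folklore] -/
theorem hasFDerivAt_dualVelocity_apply {U : ℝ × V3 → V3} (hm : a + z.1 ≠ 0)
    (hU : DifferentiableAt ℝ U (clockMap a z)) (j : Fin 3) :
    HasFDerivAt (fun w => dualVelocity a U w j)
      ((a / (a + z.1)) • fderiv ℝ (fun w => U (clockMap a w) j) z +
          U (clockMap a z) j • ((-a / (a + z.1) ^ 2) • ContinuousLinearMap.fst ℝ ℝ V3) +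
        ((1 / (a + z.1)) • (PiLp.proj 2 (fun _ : Fin 3 => ℝ) j).comp
            (ContinuousLinearMap.snd ℝ ℝ V3) +
          z.2 j • ((-1 / (a + z.1) ^ 2) • ContinuousLinearMap.fst ℝ ℝ V3))) z := by
  have hUc : DifferentiableAt ℝ (fun w => U (clockMap a w) j) z :=
    (hasFDerivAt_comp_clockMap hm (differentiableAt_euclidean.mp hU j)).differentiableAt
  exact (((hasFDerivAt_const_div_clock hm a).fun_mul hUc.hasFDerivAt).fun_add
    ((hasFDerivAt_const_div_clock hm 1).fun_mul (hasFDerivAt_coord z j))).congr_of_eventuallyEq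
    (Filter.Eventually.of_forall fun w => dualVelocity_apply a U w j)

/-- Invariance of the packing: `ρ̂ d(s)³ = ρ σ³` with `d(s) = σ(a+s)/a`. [folklore] -/
theorem dualDensity_mul_diameter_pow (ha : a ≠ 0) {w : ℝ × V3} (hw : a + w.1 ≠ 0) (σ : ℝ)
    (P : ℝ × V3 → ℝ) :
    dualDensity a P w * (σ * (a + w.1) / a) ^ 3 = P (clockMap a w) * σ ^ 3 := by
  simp only [dualDensity]
  field_simp

/-- Near a point with `a + s ≠ 0` the dual pressure `ρ̂ θ̂ Z(ρ̂ d³)` is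
`λ⁵ · (ρ θ Z(ρ σ³)) ∘ clockMap a`. [folklore] -/
theorem dualPressure_eventuallyEq (ha : a ≠ 0) (hm : a + z.1 ≠ 0) (σ : ℝ) (Z : ℝ → ℝ)
    (P Θ : ℝ × V3 → ℝ) :
    (fun w => dualDensity a P w * dualTemperature a Θ w *
        Z (dualDensity a P w * (σ * (a + w.1) / a) ^ 3)) =ᶠ[nhds z]
      fun w => (a / (a + w.1)) ^ 5 *
        (P (clockMap a w) * Θ (clockMap a w) * Z (P (clockMap a w) * σ ^ 3)) := by
  have hopen : ∀ᶠ w in nhds z, a + w.1 ≠ 0 :=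
    (continuous_const.add continuous_fst).continuousAt.eventually_ne hm
  filter_upwards [hopen] with w hw
  rw [dualDensity_mul_diameter_pow ha hw]
  simp only [dualDensity, dualTemperature]
  ring

end ClockCalculus

/-! ## The three residual identities -/

section Identities

variable {a : ℝ} {z : ℝ × V3} {P Θ : ℝ × V3 → ℝ} {U : ℝ × V3 → V3}

/-- **Mass.** The dual mass residual is `λ⁵` times the physical one at `clockMap a z`. [folklore] -/
theorem dual_mass (hm : a + z.1 ≠ 0) (hP : DifferentiableAt ℝ P (clockMap a z))
    (hU : DifferentiableAt ℝ U (clockMap a z)) :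
    dT (dualDensity a P) z + ∑ i, dX i (fun w => dualDensity a P w * dualVelocity a U w i) z =
      (a / (a + z.1)) ^ 5 *
        (dT P (clockMap a z) + ∑ i, dX i (fun w => P w * U w i) (clockMap a z)) := by
  have hUj : ∀ j, DifferentiableAt ℝ (fun w => U w j) (clockMap a z) :=
    fun j => differentiableAt_euclidean.mp hU j
  have hD : HasFDerivAt (dualDensity a P) _ z := (hasFDerivAt_clockFactor_pow hm 3).fun_mul
    (hasFDerivAt_comp_clockMap hm hP).differentiableAt.hasFDerivAt
  have hDV := fun i => (hD.fun_mul (hasFDerivAt_dualVelocity_apply hm hU i)).fderiv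
  have hPU := fun i => (hP.hasFDerivAt.fun_mul (hUj i).hasFDerivAt).fderiv
  unfold dT dX
  rw [hD.fderiv]
  simp only [hDV, hPU]
  simp only [add_apply, smul_apply, ContinuousLinearMap.coe_comp, Function.comp_apply,
    ContinuousLinearMap.coe_fst', ContinuousLinearMap.coe_snd', PiLp.proj_apply,
    fderiv_comp_clockMap_time hm hP, fderiv_comp_clockMap_space hm hP,
    fderiv_comp_clockMap_space hm (hUj _), smul_eq_mul, mul_one, mul_zero, add_zero]
  simp only [dualDensity, dualVelocity_apply, Fin.sum_univ_three, PiLp.single_apply]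
  generalize fderiv ℝ P (clockMap a z) = DP
  generalize fderiv ℝ (fun w => U w 0) (clockMap a z) = DU₀
  generalize fderiv ℝ (fun w => U w 1) (clockMap a z) = DU₁
  generalize fderiv ℝ (fun w => U w 2) (clockMap a z) = DU₂
  norm_num; field_simp; ring

/-- **Momentum** (`j`-th component). The dual momentum residual is `λ⁶` times the physical one at
`clockMap a z`; the pressure term is covariant because the packing `ρ̂ d(s)³ = ρ σ³` is, and the
Kronecker sum `∑ᵢ ûᵢ δᵢⱼ/(a+s) = ûⱼ/(a+s)` is summed before the final `ring`. [folklore] -/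
theorem dual_momentum (ha : a ≠ 0) (hm : a + z.1 ≠ 0) (σ : ℝ) (Z : ℝ → ℝ)
    (hP : DifferentiableAt ℝ P (clockMap a z)) (hΘ : DifferentiableAt ℝ Θ (clockMap a z))
    (hU : DifferentiableAt ℝ U (clockMap a z))
    (hZ : DifferentiableAt ℝ Z (P (clockMap a z) * σ ^ 3)) (j : Fin 3) :
    dualDensity a P z * (dT (fun w => dualVelocity a U w j) z +
        ∑ i, dualVelocity a U z i * dX i (fun w => dualVelocity a U w j) z) +
      dX j (fun w => dualDensity a P w * dualTemperature a Θ w *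
        Z (dualDensity a P w * (σ * (a + w.1) / a) ^ 3)) z =
    (a / (a + z.1)) ^ 6 *
      (P (clockMap a z) * (dT (fun w => U w j) (clockMap a z) +
          ∑ i, U (clockMap a z) i * dX i (fun w => U w j) (clockMap a z)) +
        dX j (fun w => P w * Θ w * Z (P w * σ ^ 3)) (clockMap a z)) := by
  have hUj : ∀ j, DifferentiableAt ℝ (fun w => U w j) (clockMap a z) :=
    fun j => differentiableAt_euclidean.mp hU j
  have hPres : DifferentiableAt ℝ (fun w => P w * Θ w * Z (P w * σ ^ 3)) (clockMap a z) :=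
    (hP.fun_mul hΘ).fun_mul (hZ.fun_comp' (clockMap a z) (hP.mul_const (σ ^ 3)))
  have hPr : HasFDerivAt (fun w => (a / (a + w.1)) ^ 5 *
      (P (clockMap a w) * Θ (clockMap a w) * Z (P (clockMap a w) * σ ^ 3))) _ z :=
    (hasFDerivAt_clockFactor_pow hm 5).fun_mul
      (hasFDerivAt_comp_clockMap hm hPres).differentiableAt.hasFDerivAt
  have hVd := fun j => (hasFDerivAt_dualVelocity_apply hm hU j).fderiv
  unfold dT dX
  rw [(dualPressure_eventuallyEq ha hm σ Z P Θ).fderiv_eq, hPr.fderiv]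
  simp only [hVd]
  simp only [add_apply, smul_apply, ContinuousLinearMap.coe_comp, Function.comp_apply,
    ContinuousLinearMap.coe_fst', ContinuousLinearMap.coe_snd', PiLp.proj_apply,
    fderiv_comp_clockMap_time hm (hUj _), fderiv_comp_clockMap_space hm (hUj _),
    fderiv_comp_clockMap_space hm hPres, smul_eq_mul, mul_one, mul_zero, add_zero]
  simp only [PiLp.single_apply, mul_ite, mul_one, mul_zero, mul_add, Finset.sum_add_distrib,
    Finset.sum_ite_eq, Finset.mem_univ, if_true]
  simp only [dualDensity, dualVelocity_apply, PiLp.zero_apply, Fin.sum_univ_three]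
  generalize fderiv ℝ (fun w => U w j) (clockMap a z) = DU
  generalize fderiv ℝ (fun w => P w * Θ w * Z (P w * σ ^ 3)) (clockMap a z) = DPr
  norm_num; field_simp; ring

/-- **Temperature.** The dual temperature residual is `λ⁴` times the physical one at `clockMap a z`
once the typed heating `(2/(a+s)) θ̂ (Z − 1)` (the anomaly `2λλ'θ + (2/3) θ̂ Z · 3λ/a`) is
subtracted. [folklore] -/
theorem dual_temperature (ha : a ≠ 0) (hm : a + z.1 ≠ 0) (σ : ℝ) (Z : ℝ → ℝ) (P : ℝ × V3 → ℝ)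
    (hΘ : DifferentiableAt ℝ Θ (clockMap a z)) (hU : DifferentiableAt ℝ U (clockMap a z)) :
    dT (dualTemperature a Θ) z + ∑ i, dualVelocity a U z i * dX i (dualTemperature a Θ) z +
          2 / 3 * dualTemperature a Θ z * Z (dualDensity a P z * (σ * (a + z.1) / a) ^ 3) *
            ∑ i, dX i (fun w => dualVelocity a U w i) z -
        2 / (a + z.1) * dualTemperature a Θ z *
          (Z (dualDensity a P z * (σ * (a + z.1) / a) ^ 3) - 1) =
      (a / (a + z.1)) ^ 4 *
        (dT Θ (clockMap a z) + ∑ i, U (clockMap a z) i * dX i Θ (clockMap a z) +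
            2 / 3 * Θ (clockMap a z) * Z (P (clockMap a z) * σ ^ 3) *
              ∑ i, dX i (fun w => U w i) (clockMap a z) -
          0 * Θ (clockMap a z) * (Z (P (clockMap a z) * σ ^ 3) - 1)) := by
  have hUj : ∀ j, DifferentiableAt ℝ (fun w => U w j) (clockMap a z) :=
    fun j => differentiableAt_euclidean.mp hU j
  have hT : HasFDerivAt (dualTemperature a Θ) _ z := (hasFDerivAt_clockFactor_pow hm 2).fun_mul
    (hasFDerivAt_comp_clockMap hm hΘ).differentiableAt.hasFDerivAt
  have hVd := fun j => (hasFDerivAt_dualVelocity_apply hm hU j).fderiv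
  rw [dualDensity_mul_diameter_pow ha hm σ P]
  unfold dT dX
  rw [hT.fderiv]
  simp only [hVd]
  simp only [add_apply, smul_apply, ContinuousLinearMap.coe_comp, Function.comp_apply,
    ContinuousLinearMap.coe_fst', ContinuousLinearMap.coe_snd', PiLp.proj_apply,
    fderiv_comp_clockMap_time hm hΘ, fderiv_comp_clockMap_space hm hΘ,
    fderiv_comp_clockMap_space hm (hUj _), smul_eq_mul, mul_one, mul_zero, add_zero]
  simp only [dualTemperature, dualVelocity_apply, Fin.sum_univ_three, PiLp.single_apply]
  generalize fderiv ℝ Θ (clockMap a z) = DΘ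
  generalize fderiv ℝ (fun w => U w 0) (clockMap a z) = DU₀
  generalize fderiv ℝ (fun w => U w 1) (clockMap a z) = DU₁
  generalize fderiv ℝ (fun w => U w 2) (clockMap a z) = DU₂
  generalize Z (P (clockMap a z) * σ ^ 3) = Zc
  norm_num; field_simp; ring

end Identities

/-! ## The registered stub -/

/-- `A = 0 ↔ B = 0` when `B = c A` with `c ≠ 0`. [folklore] -/
theorem eq_zero_iff_of_eq_mul {A B c : ℝ} (h : B = c * A) (hc : c ≠ 0) : A = 0 ↔ B = 0 := by
  rw [h, mul_eq_zero, or_iff_right hc]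

/-- `L₁ = R₁ ↔ L₂ = R₂` when `L₂ - R₂ = c (L₁ - R₁)` with `c ≠ 0`. [folklore] -/
theorem eq_iff_of_sub_eq_mul_sub {L₁ R₁ L₂ R₂ c : ℝ} (h : L₂ - R₂ = c * (L₁ - R₁))
    (hc : c ≠ 0) : L₁ = R₁ ↔ L₂ = R₂ := by
  rw [← sub_eq_zero (a := L₂), h, mul_eq_zero, or_iff_right hc, sub_eq_zero]

/-- **STUB 0 of the line `kidder-knob-melnikov`** (crux `ImplosionDichotomy.DenseExcursion`,
stmt-AtomisticToContinuum-12586; verbatim stub 3 of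
`PolynomialCompression/Lines/conformal-clock.lean`, stmt-AtomisticToContinuum-12587): the
projective (Kidder / Schrödinger) covariance of the full Euler system of a monatomic gas with a
general equation of state `p = ρ θ Z(ρ d³)` — the physical system with diameter `σ` and no heating
holds at `clockMap a (s, y)` iff the dual system with diameter `σ(a+s)/a` and heating rate
`2/(a+s)` holds at `(s, y)` for the dual fields. Pure chain rule: the dual mass / momentum /
temperature residuals are `λ⁵`, `λ⁶`, `λ⁴` times the physical ones (the last after subtracting the
typed heating), `λ = a/(a+s) ≠ 0` because `0 < a`, `0 ≤ s`. At `Z ≡ 1` this is the classical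
projective invariance of the monatomic ideal gas (D. Serre 1997, Prop. 2.1; Kidder 1974).
[folklore] -/
theorem stub_projectiveCovariance : ProjectiveCovariance := by
  intro a σ ha Z P Θ U z hz hP hΘ hU hZ
  have hm : a + z.1 ≠ 0 := by positivity
  have hℓ : a / (a + z.1) ≠ 0 := div_ne_zero ha.ne' hm
  unfold EulerZAt
  exact and_congr (eq_zero_iff_of_eq_mul (dual_mass hm hP hU) (pow_ne_zero 5 hℓ))
    (and_congr
      (forall_congr' fun j =>
        eq_zero_iff_of_eq_mul (dual_momentum ha.ne' hm σ Z hP hΘ hU hZ j) (pow_ne_zero 6 hℓ))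
      (eq_iff_of_sub_eq_mul_sub (dual_temperature ha.ne' hm σ Z P hΘ hU) (pow_ne_zero 4 hℓ)))

end Summit.AtomisticToContinuum.HydrodynamicLimit.Theorems.KidderKnobMelnikov

end
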